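import Mathlib
import HarnessLib

/-!
# The transverse smearing bound for the shell-rigidity crux (`stub_transverseSmearBound`)

Summit `QuantumFields/YangMills`, thesis `PencilRigidity.ShellRigidity` (stmt-QuantumFields-11685),
line `thales-slit-exact-cone-type`, stub P2 (helper of `stub_transversePinch`).

For a kernel `K : ℝ⁴ → ℝ`, continuous off the origin, with `|K x| ≤ C (1 + ‖x‖ ^ (-a))` and
`a > 2`, the box-smeared transverse trace at time `s > 0`,
`∫_{w ∈ Q} ∫_{w' ∈ Q} K (s, 0, w - w')` over the box `Q = [0, δ]²`, is `O(1 + s ^ (2 - a))`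
uniformly in `s > 0`.  Proof: pointwise `‖x‖ ^ (-a) = N ^ (-a/4) · N ^ (-a/4)` with
`N = s² + p² + q²`, and `N ^ (-a/4) ≤ (s² + p²) ^ (-a/4)`, so the bound factorises into two
one-dimensional profiles `g t = (s² + t²) ^ (-a/4)`, each of integral
`s ^ (1 - a/2) ∫ (1 + y²) ^ (-a/4) dy` (scaling `t = s y`; the last integral is finite because
`a/2 > 1`).  Integrating the bound over `w' ∈ Q ⊆ ℝ²` and then over `w ∈ Q` gives
`C δ⁴ + C δ² c s ^ (2 - a)`.  Everything used is Mathlib (`integrable_rpow_neg_one_add_norm_sq`,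
`Measure.integral_comp_div`, `integral_prod_mul`, translation invariance). [folklore]
-/

noncomputable section

namespace Summit.QuantumFields.YangMills.Cruxes.ShellRigidity.ThalesSlitExactConeType

open MeasureTheory Complex Real
open scoped InnerProductSpace BigOperators

local notation "E4" => EuclideanSpace ℝ (Fin 4)

namespace TransverseSmearBound

/-! ### One-dimensional profiles -/

/-- For `r > 1` the Japanese bracket `y ↦ (1 + ‖y‖²) ^ (-r/2)` is integrable on `ℝ`
(Mathlib's `integrable_rpow_neg_one_add_norm_sq` in dimension `1`). [folklore] -/
theorem integrable_one_add_norm_sq_rpow {r : ℝ} (hr : 1 < r) :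
    Integrable (fun y : ℝ => ((1 : ℝ) + ‖y‖ ^ 2) ^ (-r / 2)) := by
  have h : (Module.finrank ℝ ℝ : ℝ) < r := by simpa using hr
  exact integrable_rpow_neg_one_add_norm_sq h

/-- Scaling of the profile: `(s² + x²) ^ (-r/2) = (s²) ^ (-r/2) · (1 + ‖x/s‖²) ^ (-r/2)` for
`s > 0`. [folklore] -/
theorem profile_eq {s : ℝ} (hs : 0 < s) (r x : ℝ) :
    (s ^ 2 + x ^ 2) ^ (-r / 2) = (s ^ 2) ^ (-r / 2) * ((1 : ℝ) + ‖x / s‖ ^ 2) ^ (-r / 2) := by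
  rw [Real.norm_eq_abs, sq_abs, ← Real.mul_rpow (by positivity) (by positivity)]
  congr 1
  field_simp

/-- The profile `x ↦ (s² + x²) ^ (-r/2)` is integrable on `ℝ` for `s > 0`, `r > 1`.
[folklore] -/
theorem integrable_profile {s r : ℝ} (hs : 0 < s) (hr : 1 < r) :
    Integrable (fun x : ℝ => (s ^ 2 + x ^ 2) ^ (-r / 2)) := by
  simp_rw [profile_eq hs r]
  exact ((integrable_one_add_norm_sq_rpow hr).comp_div hs.ne').const_mul _

/-- `∫ (s² + x²) ^ (-r/2) dx = s ^ (1 - r) ∫ (1 + ‖y‖²) ^ (-r/2) dy` for `s > 0` (substitution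
`x = s y`). [folklore] -/
theorem integral_profile {s : ℝ} (hs : 0 < s) (r : ℝ) :
    ∫ x : ℝ, (s ^ 2 + x ^ 2) ^ (-r / 2) =
      s ^ (1 - r) * ∫ y : ℝ, ((1 : ℝ) + ‖y‖ ^ 2) ^ (-r / 2) := by
  simp_rw [profile_eq hs r]
  rw [integral_const_mul]
  have h := Measure.integral_comp_div (fun y : ℝ => ((1 : ℝ) + ‖y‖ ^ 2) ^ (-r / 2)) s
  rw [h, abs_of_pos hs, smul_eq_mul, ← mul_assoc]
  congr 1
  rw [← Real.rpow_two, ← Real.rpow_mul hs.le, ← Real.rpow_add_one hs.ne']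
  congr 1
  ring

/-- Integrability on `ℝ × ℝ` of the product of two translated profiles. [folklore] -/
theorem integrable_profile_prod {s r : ℝ} (hs : 0 < s) (hr : 1 < r) (c d : ℝ) :
    Integrable (fun v : ℝ × ℝ =>
      (s ^ 2 + (c - v.1) ^ 2) ^ (-r / 2) * (s ^ 2 + (d - v.2) ^ 2) ^ (-r / 2)) := by
  have h := ((integrable_profile hs hr).comp_sub_left c).mul_prod
    ((integrable_profile hs hr).comp_sub_left d)
  simpa [Measure.volume_eq_prod] using h

/-- `∫_{ℝ²} (s² + (c - v₁)²) ^ (-r/2) (s² + (d - v₂)²) ^ (-r/2) dv = s ^ (2 - 2r) I²` with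
`I = ∫ (1 + ‖y‖²) ^ (-r/2) dy` (Fubini for a product integrand, translation invariance, and
`integral_profile`). [folklore] -/
theorem integral_profile_prod {s : ℝ} (hs : 0 < s) (r c d : ℝ) :
    ∫ v : ℝ × ℝ, (s ^ 2 + (c - v.1) ^ 2) ^ (-r / 2) * (s ^ 2 + (d - v.2) ^ 2) ^ (-r / 2) =
      s ^ (2 - 2 * r) * (∫ y : ℝ, ((1 : ℝ) + ‖y‖ ^ 2) ^ (-r / 2)) ^ 2 := by
  rw [Measure.volume_eq_prod]
  have h := integral_prod_mul (μ := (volume : Measure ℝ)) (ν := (volume : Measure ℝ))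
    (fun t : ℝ => (s ^ 2 + (c - t) ^ 2) ^ (-r / 2)) (fun t : ℝ => (s ^ 2 + (d - t) ^ 2) ^ (-r / 2))
  rw [h]
  have h1 := integral_sub_left_eq_self (fun t : ℝ => (s ^ 2 + t ^ 2) ^ (-r / 2)) (μ := volume) c
  have h2 := integral_sub_left_eq_self (fun t : ℝ => (s ^ 2 + t ^ 2) ^ (-r / 2)) (μ := volume) d
  rw [h1, h2, integral_profile hs r, mul_mul_mul_comm, ← Real.rpow_add hs, ← sq]
  congr 1
  ring_nf

/-! ### The box, the pointwise bound and its integrals -/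

/-- The box `[0, δ]²` has Lebesgue measure `δ²`. [folklore] -/
theorem volume_box {δ : ℝ} (hδ : 0 ≤ δ) :
    volume (Set.Icc (0 : ℝ) δ ×ˢ Set.Icc (0 : ℝ) δ) = ENNReal.ofReal (δ ^ 2) := by
  rw [Measure.volume_eq_prod, Measure.prod_prod, Real.volume_Icc, sub_zero,
    ← ENNReal.ofReal_mul hδ, sq]

/-- The box `[0, δ]²` has real Lebesgue measure `δ²`. [folklore] -/
theorem volume_real_box {δ : ℝ} (hδ : 0 ≤ δ) :
    volume.real (Set.Icc (0 : ℝ) δ ×ˢ Set.Icc (0 : ℝ) δ) = δ ^ 2 := by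
  rw [measureReal_def, volume_box hδ, ENNReal.toReal_ofReal (by positivity)]

/-- Pointwise: for `s > 0`,
`K (s, 0, p, q) ≤ max C 0 · (1 + (s² + p²) ^ (-a/4) (s² + q²) ^ (-a/4))`,
from `|K x| ≤ C (1 + ‖x‖ ^ (-a))`, `‖x‖² = s² + p² + q²` and
`N ^ (-a/2) = N ^ (-a/4) N ^ (-a/4) ≤ (s² + p²) ^ (-a/4) (s² + q²) ^ (-a/4)`. [folklore] -/
theorem kernel_le (K : E4 → ℝ) (C a : ℝ) (ha : 0 ≤ a)
    (hdecay : ∀ x : E4, x ≠ 0 → |K x| ≤ C * (1 + ‖x‖ ^ (-a)))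
    {s : ℝ} (hs : 0 < s) (p q : ℝ) :
    K (WithLp.toLp 2 ![s, 0, p, q]) ≤
      max C 0 * (1 + (s ^ 2 + p ^ 2) ^ (-(a / 2) / 2) * (s ^ 2 + q ^ 2) ^ (-(a / 2) / 2)) := by
  set x : E4 := WithLp.toLp 2 ![s, 0, p, q] with hx
  have hx0 : x ≠ 0 := by
    intro h
    have h0 : x 0 = s := by simp [hx]
    rw [h] at h0
    simp at h0
    exact hs.ne' h0.symm
  have hnorm : ‖x‖ ^ 2 = s ^ 2 + p ^ 2 + q ^ 2 := by
    rw [EuclideanSpace.real_norm_sq_eq, Fin.sum_univ_four]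
    simp [hx]
  have hN : 0 < s ^ 2 + p ^ 2 + q ^ 2 := by positivity
  have hrpow : ‖x‖ ^ (-a) =
      (s ^ 2 + p ^ 2 + q ^ 2) ^ (-(a / 2) / 2) * (s ^ 2 + p ^ 2 + q ^ 2) ^ (-(a / 2) / 2) := by
    rw [← Real.rpow_add hN, ← hnorm, ← Real.rpow_two, ← Real.rpow_mul (norm_nonneg _)]
    congr 1
    ring
  have h1 : (s ^ 2 + p ^ 2 + q ^ 2) ^ (-(a / 2) / 2) ≤ (s ^ 2 + p ^ 2) ^ (-(a / 2) / 2) :=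
    Real.rpow_le_rpow_of_nonpos (by positivity) (by nlinarith [sq_nonneg q]) (by linarith)
  have h2 : (s ^ 2 + p ^ 2 + q ^ 2) ^ (-(a / 2) / 2) ≤ (s ^ 2 + q ^ 2) ^ (-(a / 2) / 2) :=
    Real.rpow_le_rpow_of_nonpos (by positivity) (by nlinarith [sq_nonneg p]) (by linarith)
  calc K x ≤ |K x| := le_abs_self _
    _ ≤ C * (1 + ‖x‖ ^ (-a)) := hdecay x hx0
    _ ≤ max C 0 * (1 + ‖x‖ ^ (-a)) :=
        mul_le_mul_of_nonneg_right (le_max_left _ _) (by positivity)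
    _ ≤ max C 0 * (1 + (s ^ 2 + p ^ 2) ^ (-(a / 2) / 2) * (s ^ 2 + q ^ 2) ^ (-(a / 2) / 2)) := by
        rw [hrpow]
        gcongr

/-- The smeared kernel `w' ↦ K (s, 0, c - w'₁, d - w'₂)` (`s > 0`) is integrable on every compact
set: it is continuous, as the affine map misses the origin. [folklore] -/
theorem kernel_integrableOn (K : E4 → ℝ) (hcont : ContinuousOn K {x : E4 | x ≠ 0})
    {s : ℝ} (hs : 0 < s) (c d : ℝ) {Q : Set (ℝ × ℝ)} (hQ : IsCompact Q) :
    IntegrableOn (fun w' : ℝ × ℝ => K (WithLp.toLp 2 ![s, 0, c - w'.1, d - w'.2])) Q := by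
  refine ContinuousOn.integrableOn_compact hQ (Continuous.continuousOn ?_)
  refine hcont.comp_continuous (by fun_prop) (fun w' => ?_)
  intro h
  have h0 : (WithLp.toLp 2 ![s, 0, c - w'.1, d - w'.2] : E4) 0 = s := by simp
  rw [h] at h0
  simp at h0
  exact hs.ne' h0.symm

/-- A function bounded above by a constant `M ≥ 0` has set integral at most `M · μ.real s` over a
set of finite measure (no measurability needed: a non-integrable function integrates to `0`).
[folklore] -/
theorem setIntegral_le_of_le_const {X : Type*} [MeasurableSpace X] {μ : Measure X} {s : Set X}
    {f : X → ℝ} {M : ℝ} (hs : μ s ≠ ⊤) (hM : 0 ≤ M) (hf : ∀ x, f x ≤ M) :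
    ∫ x in s, f x ∂μ ≤ M * μ.real s := by
  by_cases hfi : IntegrableOn f s μ
  · calc ∫ x in s, f x ∂μ ≤ ∫ _ in s, M ∂μ :=
          setIntegral_mono hfi (integrableOn_const hs) (fun x => hf x)
      _ = M * μ.real s := by rw [setIntegral_const, smul_eq_mul, mul_comm]
  · rw [integral_undef hfi]
    exact mul_nonneg hM measureReal_nonneg

/-- The inner estimate: for every `w ∈ ℝ²`,
`∫_{w' ∈ [0,δ]²} K (s, 0, w - w') ≤ max C 0 · (δ² + s ^ (2 - a) I²)` with
`I = ∫ (1 + ‖y‖²) ^ (-a/4) dy`: bound the integrand pointwise (`kernel_le`), integrate the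
constant over the box and the profile product over all of `ℝ²` (`integral_profile_prod`).
[folklore] -/
theorem inner_bound (K : E4 → ℝ) (C a : ℝ) (ha2 : 2 < a)
    (hcont : ContinuousOn K {x : E4 | x ≠ 0})
    (hdecay : ∀ x : E4, x ≠ 0 → |K x| ≤ C * (1 + ‖x‖ ^ (-a)))
    (δ : ℝ) (hδ : 0 < δ) {s : ℝ} (hs : 0 < s) (w : ℝ × ℝ) :
    ∫ w' in Set.Icc (0 : ℝ) δ ×ˢ Set.Icc (0 : ℝ) δ,
        K (WithLp.toLp 2 ![s, 0, w.1 - w'.1, w.2 - w'.2]) ≤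
      max C 0 * (δ ^ 2 + s ^ (2 - a) * (∫ y : ℝ, ((1 : ℝ) + ‖y‖ ^ 2) ^ (-(a / 2) / 2)) ^ 2) := by
  set Q : Set (ℝ × ℝ) := Set.Icc (0 : ℝ) δ ×ˢ Set.Icc (0 : ℝ) δ with hQ
  have hr1 : 1 < a / 2 := by linarith
  have hQfin : volume Q ≠ ⊤ := by rw [hQ, volume_box hδ.le]; exact ENNReal.ofReal_ne_top
  have hPint := integrable_profile_prod hs hr1 w.1 w.2
  have hPI := integral_profile_prod hs (a / 2) w.1 w.2
  have hKint :
      IntegrableOn (fun w' : ℝ × ℝ => K (WithLp.toLp 2 ![s, 0, w.1 - w'.1, w.2 - w'.2])) Q :=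
    kernel_integrableOn K hcont hs w.1 w.2 (isCompact_Icc.prod isCompact_Icc)
  have h1int : IntegrableOn (fun _ : ℝ × ℝ => (1 : ℝ)) Q := integrableOn_const hQfin
  have hBint : IntegrableOn (fun w' : ℝ × ℝ => max C 0 * (1 +
      (s ^ 2 + (w.1 - w'.1) ^ 2) ^ (-(a / 2) / 2) *
        (s ^ 2 + (w.2 - w'.2) ^ 2) ^ (-(a / 2) / 2))) Q :=
    (h1int.add hPint.integrableOn).const_mul _
  calc ∫ w' in Q, K (WithLp.toLp 2 ![s, 0, w.1 - w'.1, w.2 - w'.2])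
      ≤ ∫ w' in Q, max C 0 * (1 +
          (s ^ 2 + (w.1 - w'.1) ^ 2) ^ (-(a / 2) / 2) *
            (s ^ 2 + (w.2 - w'.2) ^ 2) ^ (-(a / 2) / 2)) :=
        setIntegral_mono hKint hBint (fun w' => kernel_le K C a (by linarith) hdecay hs _ _)
    _ = max C 0 * (volume.real Q + ∫ w' in Q,
          (s ^ 2 + (w.1 - w'.1) ^ 2) ^ (-(a / 2) / 2) *
            (s ^ 2 + (w.2 - w'.2) ^ 2) ^ (-(a / 2) / 2)) := by
        rw [integral_const_mul, integral_add h1int.integrable hPint.integrableOn.integrable,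
          setIntegral_const, smul_eq_mul, mul_one]
    _ ≤ max C 0 * (δ ^ 2 +
          s ^ (2 - a) * (∫ y : ℝ, ((1 : ℝ) + ‖y‖ ^ 2) ^ (-(a / 2) / 2)) ^ 2) := by
        rw [hQ, volume_real_box hδ.le, show 2 - a = 2 - 2 * (a / 2) by ring, ← hPI]
        refine mul_le_mul_of_nonneg_left (add_le_add le_rfl ?_) (le_max_right _ _)
        exact setIntegral_le_integral hPint (Filter.Eventually.of_forall fun v => by positivity)

end TransverseSmearBound

open TransverseSmearBound in
/-- **Stub P2 · the transverse smearing bound.** `K` continuous off `0` with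
`|K x| ≤ C(1 + ‖x‖^{-a})`, `a > 2`: the box-smeared transverse trace at time `s > 0` is
`O(1 + s^{2-a})` uniformly in `s`:
`∫_Q∫_Q K(s, 0, w - w') dw' dw ≤ C₀ δ⁴ + C₀ δ² I² s^{2-a}` with `Q = [0,δ]²`, `C₀ = max C 0` and
`I = ∫ (1 + y²)^{-a/4} dy < ∞` (`a/2 > 1`) — the smearing gains the two transverse dimensions
(outer integral by `setIntegral_le_of_le_const`, inner by `inner_bound`).
Helper for `stub_transversePinch` of line `thales-slit-exact-cone-type`. [folklore] -/
theorem stub_transverseSmearBound (K : E4 → ℝ) (C a : ℝ) (ha2 : 2 < a)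
    (hcont : ContinuousOn K {x : E4 | x ≠ 0})
    (hdecay : ∀ x : E4, x ≠ 0 → |K x| ≤ C * (1 + ‖x‖ ^ (-a)))
    (δ : ℝ) (hδ : 0 < δ) :
    ∃ C' : ℝ, ∀ s : ℝ, 0 < s →
      ∫ w in Set.Icc (0 : ℝ) δ ×ˢ Set.Icc (0 : ℝ) δ, ∫ w' in Set.Icc (0 : ℝ) δ ×ˢ Set.Icc (0 : ℝ) δ,
          K (WithLp.toLp 2 ![s, 0, w.1 - w'.1, w.2 - w'.2]) ≤ C' * (1 + s ^ (2 - a)) := by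
  set I : ℝ := ∫ y : ℝ, ((1 : ℝ) + ‖y‖ ^ 2) ^ (-(a / 2) / 2)
  set C₀ : ℝ := max C 0
  have hC₀0 : 0 ≤ C₀ := le_max_right _ _
  refine ⟨C₀ * δ ^ 4 + C₀ * δ ^ 2 * I ^ 2, fun s hs => ?_⟩
  have hQfin : volume (Set.Icc (0 : ℝ) δ ×ˢ Set.Icc (0 : ℝ) δ) ≠ ⊤ := by
    rw [volume_box hδ.le]; exact ENNReal.ofReal_ne_top
  have hS : 0 ≤ s ^ (2 - a) := by positivity
  have hM : 0 ≤ C₀ * (δ ^ 2 + s ^ (2 - a) * I ^ 2) := by positivity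
  have houter := setIntegral_le_of_le_const hQfin hM
    (fun w => inner_bound K C a ha2 hcont hdecay δ hδ hs w)
  rw [volume_real_box hδ.le] at houter
  refine houter.trans ?_
  nlinarith [mul_nonneg (mul_nonneg hC₀0 (sq_nonneg δ)) (sq_nonneg I),
    mul_nonneg (mul_nonneg hC₀0 (pow_nonneg hδ.le 4)) hS]

end Summit.QuantumFields.YangMills.Cruxes.ShellRigidity.ThalesSlitExactConeType
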